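import Mathlib.Analysis.SpecialFunctions.Pow.Real
import HarnessLib

/-!
# Route `UnitScaleTilt`, crux K1 «MinimiserStabilityRegPr» (stmt-QuantumFields-19200), route-R E′ (A′)-on-Σ, P-A2 (β), row «(n3)-comb» —
# (O2) GROUNDWORK, file F-8b-5a: ★routeR-w6's GAUGE ROW (F-6d-3) IN KERNEL FORM — `λ² ≤ Σ_{i ≤ k′} (√L)^{k′+1−i}·(Γc·GRAD_i + Μc_i·MASS_i + Δc·DEF_i)`

«(O2) groundwork — not consumed by any displayed row before the freeze lifts» (★★OWNER `ym3-torus-plan` g29∕g30 RULINGS №20 (2), №22 (c) «(II) GO»).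
Cell `ym3-torus`, width seat `ym-ust-19200-w5` (gen 8); pen F-8b (★routeR-w1 g9 PENS ROUND 5), file 5a.  THEOREMS ONLY (0 `def`, 0 `sorry`); `--supports stmt-QuantumFields-19200
--as helper`, count-neutral.  Pure real analysis (Mathlib only).  YM₃ on T³ is a ladder rung (R3), not the Clay problem; nothing here claims `hMcomb`, (β), the stub, the crux,
d = 4 or the mass gap.

THE POINT.  ★routeR-w6 g9's F-6d-3 ★★★`Prop7CornerCombCellKnit.sum_cell_normSq_covGrad_gauge_le` bounds the covariant gradient energy `λ²_{k′+1}` of the accumulated gauge function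
over the level-`(k′+1)` period cell by THREE weighted groups of the lower levels' cell energies — TOP (`i = k′`: `3·d·((L^{k′+1}−1)∕2)²·L^{−2k′}·[2L^{1−d}·L·GRAD_{k′} + 2L⁻ᵈ(8((d+1)L)²a_{k′}
+ 8w)²·d·MASS_{k′}]`), COMB (`i < k′`: weights `2d·c_L·(√L)^{k′−1−i}·((L^{i+1}−1)∕2)²`, twice `[L^{−2i}(L⁻ᵈ(3N(n+1)²d²Aᵈ·GRAD_i + P_i·d²Aᵈ·MASS_i) + 3L⁻²L⁻ᵈ·d·DEF_i)]`) and O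
(`i ≤ k′`: weights `2c_L(√L)^{k′−i}`, twice `[(N∕2)d²(L−1)²L²·d·GRAD_i + (8d⁶(L−1)⁶ + 2Nd⁵(L−1)⁴L²)a_i²·d·MASS_i]`), `c_L = (1 − (√L)⁻¹)⁻¹`.  This file reads that literal right-hand
side, with the cell energies as ABSTRACT nonnegative sequences `Γ Μ Δ : ℕ → ℝ`, into the ONE-KERNEL form consumed by ✓F-7c-3 `lam_closure` ∕ ✓F-8b-4's displayed `hrow`:
★★★ `gauge_row_kernel_le`: `RHS ≤ Σ_{i ≤ k′} (√L)^{k′+1−i}·(Γc·Γ_i + Μc_i·Μ_i + Δc·Δ_i)` with the closed letters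
`Γc = 3·[(√L)⁻¹·d(L²∕4)(2(Lᵈ)⁻¹L·L) + L⁻¹·d·c_L·L²·(Lᵈ)⁻¹3N(n+1)²d²Aᵈ + (√L)⁻¹·4c_L·(N∕2)d²(L−1)²L²·d]`, `Μc_i` (the windows `a_i`, `δ_i`, `w` inside), `Δc = 3·L⁻¹·3d²c_L·(Lᵈ)⁻¹`
(the factor `3·(…)` embraces all three groups, as in print and in F-6d-3 — ★routeR-w6 g9's 11:25Z read)
(§1 `weight_sq_le`: `((L^{i+1}−1)∕2)²·((Lⁱ)⁻¹)² ≤ L²∕4`; §1 the kernel shifts `(√L)^{k′−1−i} = (√L)^{k′+1−i}·L⁻¹`, `(√L)^{k′−i} = (√L)^{k′+1−i}·(√L)⁻¹`).  F-8b-5b feeds it the cell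
energies of `G̃ = G^{lin} + N` and the DEF slot `2·DEF² + 2·source²` (✓F-5a∕F-5c∕F-7b-1 §3), landing in ✓F-8b-4's `hrow` letters.
HONEST SCOPE.  Real-number bookkeeping; no lattice object; constants kept literal (no numerals in `d`, `L`).

References: T. Bałaban, CMP **109** (1987) 249–301 [Balaban1987RG1] ((0.1), (0.4) pp.251–253); CMP **98** (1985) 17–51 [Balaban1985Averaging] ((2), (42)–(47), (112),
(125)–(126)); [Balaban1983RegularityDecay] ((2.27) p.580).
-/

set_option autoImplicit false

noncomputable section

open scoped BigOperators
open Finset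

namespace Summit.QuantumFields.YangMills.Theorems.Prop7CornerCombGaugeRowKernel

/-! ## §1 The weights -/

/-- `((L^{i+1} − 1)∕2)²·((Lⁱ)⁻¹)² ≤ L²∕4` (`L ≥ 1`). [folklore] -/
theorem weight_sq_le {L : ℝ} (hL : 1 ≤ L) (i : ℕ) : (((L ^ (i + 1) - 1) / 2) ^ 2 * ((L ^ i)⁻¹) ^ 2) ≤ L ^ 2 / 4 := by
  have hLi : 0 < L ^ i := pow_pos (by linarith) i
  have h1 : 0 ≤ (L ^ (i + 1) - 1) / 2 := by
    have : 1 ≤ L ^ (i + 1) := one_le_pow₀ hL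
    linarith
  have h2 : (L ^ (i + 1) - 1) / 2 ≤ L ^ i * (L / 2) := by rw [pow_succ]; linarith
  have h3 : ((L ^ (i + 1) - 1) / 2) ^ 2 ≤ (L ^ i * (L / 2)) ^ 2 := pow_le_pow_left₀ h1 h2 2
  calc ((L ^ (i + 1) - 1) / 2) ^ 2 * ((L ^ i)⁻¹) ^ 2 ≤ (L ^ i * (L / 2)) ^ 2 * ((L ^ i)⁻¹) ^ 2 :=
        mul_le_mul_of_nonneg_right h3 (sq_nonneg _)
    _ = L ^ 2 / 4 := by field_simp; ring

/-- The comb kernel shift: `s^{k′−1−i} = s^{k′+1−i}·L⁻¹` for `i < k′`, `s² = L ≠ 0`. [folklore] -/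
theorem pow_comb {s L : ℝ} (hL : L ≠ 0) (hs2 : s ^ 2 = L) {i k' : ℕ} (hi : i < k') : s ^ (k' - 1 - i) = s ^ (k' + 1 - i) * L⁻¹ := by
  rw [show k' + 1 - i = (k' - 1 - i) + 2 by omega, pow_add, hs2, mul_assoc, mul_inv_cancel₀ hL, mul_one]

/-- The O-group kernel shift: `s^{k′−i} = s^{k′+1−i}·s⁻¹` for `i ≤ k′`, `s ≠ 0`. [folklore] -/
theorem pow_O {s : ℝ} (hs : s ≠ 0) {i k' : ℕ} (hi : i ≤ k') : s ^ (k' - i) = s ^ (k' + 1 - i) * s⁻¹ := by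
  rw [show k' + 1 - i = (k' - i) + 1 by omega, pow_succ, mul_assoc, mul_inv_cancel₀ hs, mul_one]

/-- `0 ≤ c_L = (1 − (√L)⁻¹)⁻¹` for `L > 1`. [folklore] -/
theorem cL_nonneg {L : ℝ} (hL : 1 < L) : 0 ≤ (1 - (Real.sqrt L)⁻¹)⁻¹ := by
  have hs : 1 < Real.sqrt L := by
    have := Real.sqrt_lt_sqrt (by norm_num) hL
    rwa [Real.sqrt_one] at this
  have : (Real.sqrt L)⁻¹ < 1 := inv_lt_one_of_one_lt₀ hs
  exact inv_nonneg.mpr (by linarith)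

/-! ## §2 ★★★ The gauge row in kernel form -/

set_option maxHeartbeats 400000 in
/-- ★★★ **★routeR-w6's GAUGE ROW (F-6d-3) IN ONE-KERNEL FORM.**  For `L ≥ 2`, naturals `d N n A k′`, windows `a δ wq : ℕ → ℝ` (`a ≥ 0`; `wq k′` is F-6d-3's top loop window `w`), and ABSTRACT nonnegative level
sequences `Γ Μ Δ : ℕ → ℝ` (in F-8b-5b: the cell energies `GRADc_i(G̃)`, `MASSc_i(G̃)` and the step-defect slot `DEFc_i` of F-6d-3), the literal right-hand side of
✓`Prop7CornerCombCellKnit.sum_cell_normSq_covGrad_gauge_le` (TOP + COMB + O groups, the twice-repeated brackets kept) is at most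
`Σ_{i ∈ range (k′+1)} (√L)^{k′+1−i}·(Γc·Γ i + Μc i·Μ i + Δc·Δ i)` with the closed letters displayed in the statement.
[Balaban1987RG1 (0.1)∕(0.4) pp.251–253; Balaban1985Averaging (125)–(126) p.36]
(Decl-local heartbeat budget 400000 ≤ the cell's un-worded ceiling: three `ring` normalisations of the literal F-6d-3 weights.) -/
theorem gauge_row_kernel_le (L : ℕ) (hL : 2 ≤ L) (d N n A k' : ℕ) (a δ Γ Μ Δ wq : ℕ → ℝ) (ha : ∀ i, 0 ≤ a i)
    (hΓ : ∀ i, 0 ≤ Γ i) (hΜ : ∀ i, 0 ≤ Μ i) (hΔ : ∀ i, 0 ≤ Δ i) :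
    3 * ((d : ℝ) * (((L : ℝ) ^ (k' + 1) - 1) / 2) ^ 2 * (((L : ℝ) ^ k')⁻¹ ^ 2 *
              (2 * ((L : ℝ) ^ d)⁻¹ * (L : ℝ) * ((L : ℝ) * Γ k')
                + 2 * ((L : ℝ) ^ d)⁻¹ * (8 * (((d : ℝ) + 1) * (L : ℝ)) ^ 2 * a k' + 8 * wq k') ^ 2 * ((d : ℝ) * Μ k')))
          + 2 * (d : ℝ) * (1 - (Real.sqrt L)⁻¹)⁻¹
              * ∑ j ∈ range k', (Real.sqrt L) ^ (k' - 1 - j) * (((L : ℝ) ^ (j + 1) - 1) / 2) ^ 2 *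
                (((L : ℝ) ^ j)⁻¹ ^ 2 *
                  (((L : ℝ) ^ d)⁻¹ *
                      (3 * N * ((n : ℝ) + 1) ^ 2 * ((d : ℝ) * ((d : ℝ) * ((A : ℝ) ^ d * Γ j)))
                        + (12 * N * ((n : ℝ) + 1) ^ 2 * (d : ℝ) ^ 3 * (n : ℝ) ^ 2 * a j ^ 2
                            + 3 * (2 * d * L * δ j + 2 * ((3 * d + 1) * n : ℝ) ^ 2 * a j) ^ 2) * ((d : ℝ) * ((d : ℝ) * ((A : ℝ) ^ d * Μ j))))
                    + 3 * ((L : ℝ) ^ 2)⁻¹ * ((L : ℝ) ^ d)⁻¹ * ((d : ℝ) * Δ j))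
                + ((L : ℝ) ^ j)⁻¹ ^ 2 *
                  (((L : ℝ) ^ d)⁻¹ *
                      (3 * N * ((n : ℝ) + 1) ^ 2 * ((d : ℝ) * ((d : ℝ) * ((A : ℝ) ^ d * Γ j)))
                        + (12 * N * ((n : ℝ) + 1) ^ 2 * (d : ℝ) ^ 3 * (n : ℝ) ^ 2 * a j ^ 2
                            + 3 * (2 * d * L * δ j + 2 * ((3 * d + 1) * n : ℝ) ^ 2 * a j) ^ 2) * ((d : ℝ) * ((d : ℝ) * ((A : ℝ) ^ d * Μ j))))
                    + 3 * ((L : ℝ) ^ 2)⁻¹ * ((L : ℝ) ^ d)⁻¹ * ((d : ℝ) * Δ j)))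
          + 2 * (1 - (Real.sqrt L)⁻¹)⁻¹ * ∑ i ∈ range (k' + 1), (Real.sqrt L) ^ (k' - i) *
              ((N / 2 * (d : ℝ) ^ 2 * ((L : ℝ) - 1) ^ 2 * (L : ℝ) ^ 2 * ((d : ℝ) * Γ i)
                + (8 * (d : ℝ) ^ 6 * ((L : ℝ) - 1) ^ 6 + 2 * N * (d : ℝ) ^ 5 * ((L : ℝ) - 1) ^ 4 * (L : ℝ) ^ 2) * a i ^ 2 * ((d : ℝ) * Μ i))
              + (N / 2 * (d : ℝ) ^ 2 * ((L : ℝ) - 1) ^ 2 * (L : ℝ) ^ 2 * ((d : ℝ) * Γ i)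
                + (8 * (d : ℝ) ^ 6 * ((L : ℝ) - 1) ^ 6 + 2 * N * (d : ℝ) ^ 5 * ((L : ℝ) - 1) ^ 4 * (L : ℝ) ^ 2) * a i ^ 2 * ((d : ℝ) * Μ i))))
      ≤ ∑ i ∈ range (k' + 1), (Real.sqrt L) ^ (k' + 1 - i) *
          (3 * ((Real.sqrt L)⁻¹ * ((d : ℝ) * ((L : ℝ) ^ 2 / 4) * (2 * ((L : ℝ) ^ d)⁻¹ * (L : ℝ) * (L : ℝ)))
              + (L : ℝ)⁻¹ * (2 * (d : ℝ) * (1 - (Real.sqrt L)⁻¹)⁻¹ * ((L : ℝ) ^ 2 / 4) * 2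
                  * (((L : ℝ) ^ d)⁻¹ * (3 * N * ((n : ℝ) + 1) ^ 2 * ((d : ℝ) * ((d : ℝ) * (A : ℝ) ^ d)))))
              + (Real.sqrt L)⁻¹ * (2 * (1 - (Real.sqrt L)⁻¹)⁻¹ * 2 * (N / 2 * (d : ℝ) ^ 2 * ((L : ℝ) - 1) ^ 2 * (L : ℝ) ^ 2 * (d : ℝ))))
            * Γ i
          + 3 * ((Real.sqrt L)⁻¹ * ((d : ℝ) * ((L : ℝ) ^ 2 / 4) * (2 * ((L : ℝ) ^ d)⁻¹ * (8 * (((d : ℝ) + 1) * (L : ℝ)) ^ 2 * a i + 8 * wq i) ^ 2 * (d : ℝ)))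
              + (L : ℝ)⁻¹ * (2 * (d : ℝ) * (1 - (Real.sqrt L)⁻¹)⁻¹ * ((L : ℝ) ^ 2 / 4) * 2
                  * (((L : ℝ) ^ d)⁻¹ * ((12 * N * ((n : ℝ) + 1) ^ 2 * (d : ℝ) ^ 3 * (n : ℝ) ^ 2 * a i ^ 2
                      + 3 * (2 * d * L * δ i + 2 * ((3 * d + 1) * n : ℝ) ^ 2 * a i) ^ 2) * ((d : ℝ) * ((d : ℝ) * (A : ℝ) ^ d)))))
              + (Real.sqrt L)⁻¹ * (2 * (1 - (Real.sqrt L)⁻¹)⁻¹ * 2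
                  * ((8 * (d : ℝ) ^ 6 * ((L : ℝ) - 1) ^ 6 + 2 * N * (d : ℝ) ^ 5 * ((L : ℝ) - 1) ^ 4 * (L : ℝ) ^ 2) * a i ^ 2 * (d : ℝ))))
            * Μ i
          + 3 * ((L : ℝ)⁻¹ * (2 * (d : ℝ) * (1 - (Real.sqrt L)⁻¹)⁻¹ * ((L : ℝ) ^ 2 / 4) * 2 * (3 * ((L : ℝ) ^ 2)⁻¹ * ((L : ℝ) ^ d)⁻¹ * (d : ℝ))))
            * Δ i) := by
  -- letters (opaque: `generalize`, not `set` — the doubled brackets of the knit must never be unfolded by `whnf`)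
  have hL1 : (1 : ℝ) ≤ (L : ℝ) := by exact_mod_cast (show 1 ≤ L by omega)
  have hL0 : (0 : ℝ) < (L : ℝ) := by linarith
  have hL1' : (1 : ℝ) < (L : ℝ) := by exact_mod_cast (show 1 < L by omega)
  have hcL0' : 0 ≤ (1 - (Real.sqrt (L : ℝ))⁻¹)⁻¹ := cL_nonneg hL1'
  have hs0' : 0 < Real.sqrt (L : ℝ) := Real.sqrt_pos.mpr hL0
  have hs2' : Real.sqrt (L : ℝ) ^ 2 = L := Real.sq_sqrt hL0.le
  generalize hs : Real.sqrt (L : ℝ) = s at hcL0' hs0' hs2' ⊢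
  have hs0 : 0 < s := hs0'
  have hsi0 : 0 ≤ s⁻¹ := inv_nonneg.mpr hs0.le
  have hs2 : s ^ 2 = (L : ℝ) := hs2'
  generalize hcL : (1 - s⁻¹)⁻¹ = cL at hcL0' ⊢
  have hcL0 : 0 ≤ cL := hcL0'
  have hLd0 : 0 ≤ ((L : ℝ) ^ d)⁻¹ := by positivity
  -- the three coefficient families (opaque letters with their defining equations)
  obtain ⟨tG, htG⟩ : ∃ t : ℝ, t = s⁻¹ * ((d : ℝ) * ((L : ℝ) ^ 2 / 4) * (2 * ((L : ℝ) ^ d)⁻¹ * (L : ℝ) * (L : ℝ))) := ⟨_, rfl⟩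
  obtain ⟨cG, hcG⟩ : ∃ t : ℝ, t = (L : ℝ)⁻¹ * (2 * (d : ℝ) * cL * ((L : ℝ) ^ 2 / 4) * 2
      * (((L : ℝ) ^ d)⁻¹ * (3 * N * ((n : ℝ) + 1) ^ 2 * ((d : ℝ) * ((d : ℝ) * (A : ℝ) ^ d))))) := ⟨_, rfl⟩
  obtain ⟨oG, hoG⟩ : ∃ t : ℝ, t = s⁻¹ * (2 * cL * 2 * (N / 2 * (d : ℝ) ^ 2 * ((L : ℝ) - 1) ^ 2 * (L : ℝ) ^ 2 * (d : ℝ))) := ⟨_, rfl⟩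
  obtain ⟨tM, htM⟩ : ∃ t : ℕ → ℝ, t = fun i => s⁻¹ * ((d : ℝ) * ((L : ℝ) ^ 2 / 4)
      * (2 * ((L : ℝ) ^ d)⁻¹ * (8 * (((d : ℝ) + 1) * (L : ℝ)) ^ 2 * a i + 8 * wq i) ^ 2 * (d : ℝ))) := ⟨_, rfl⟩
  obtain ⟨P, hP⟩ : ∃ t : ℕ → ℝ, t = fun i => 12 * N * ((n : ℝ) + 1) ^ 2 * (d : ℝ) ^ 3 * (n : ℝ) ^ 2 * a i ^ 2
      + 3 * (2 * d * L * δ i + 2 * ((3 * d + 1) * n : ℝ) ^ 2 * a i) ^ 2 := ⟨_, rfl⟩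
  obtain ⟨cM, hcM⟩ : ∃ t : ℕ → ℝ, t = fun i => (L : ℝ)⁻¹ * (2 * (d : ℝ) * cL * ((L : ℝ) ^ 2 / 4) * 2
      * (((L : ℝ) ^ d)⁻¹ * (P i * ((d : ℝ) * ((d : ℝ) * (A : ℝ) ^ d))))) := ⟨_, rfl⟩
  obtain ⟨oM, hoM⟩ : ∃ t : ℕ → ℝ, t = fun i => s⁻¹ * (2 * cL * 2
      * ((8 * (d : ℝ) ^ 6 * ((L : ℝ) - 1) ^ 6 + 2 * N * (d : ℝ) ^ 5 * ((L : ℝ) - 1) ^ 4 * (L : ℝ) ^ 2) * a i ^ 2 * (d : ℝ))) := ⟨_, rfl⟩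
  obtain ⟨cD, hcD⟩ : ∃ t : ℝ, t = (L : ℝ)⁻¹ * (2 * (d : ℝ) * cL * ((L : ℝ) ^ 2 / 4) * 2 * (3 * ((L : ℝ) ^ 2)⁻¹ * ((L : ℝ) ^ d)⁻¹ * (d : ℝ))) := ⟨_, rfl⟩
  have hP0 : ∀ i, 0 ≤ P i := fun i => by rw [hP]; positivity
  have htG0 : 0 ≤ tG := by rw [htG]; positivity
  have hcG0 : 0 ≤ cG := by rw [hcG]; positivity
  have hoG0 : 0 ≤ oG := by
    rw [hoG]
    have : 0 ≤ ((L : ℝ) - 1) ^ 2 := sq_nonneg _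
    positivity
  have htM0 : ∀ i, 0 ≤ tM i := fun i => by rw [htM]; have := ha i; positivity
  have hcM0 : ∀ i, 0 ≤ cM i := fun i => by rw [hcM]; have := hP0 i; positivity
  have hoM0 : ∀ i, 0 ≤ oM i := fun i => by
    rw [hoM]
    have h6 : 0 ≤ ((L : ℝ) - 1) ^ 6 := by positivity
    have h4 : 0 ≤ ((L : ℝ) - 1) ^ 4 := by positivity
    have := ha i
    positivity
  have hcD0 : 0 ≤ cD := by rw [hcD]; positivity
  have hker0 : ∀ i, 0 ≤ s ^ (k' + 1 - i) := fun i => pow_nonneg hs0.le _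
  -- TOP
  have hwt := weight_sq_le hL1 k'
  have hTOP : (d : ℝ) * (((L : ℝ) ^ (k' + 1) - 1) / 2) ^ 2 * (((L : ℝ) ^ k')⁻¹ ^ 2 *
        (2 * ((L : ℝ) ^ d)⁻¹ * (L : ℝ) * ((L : ℝ) * Γ k')
          + 2 * ((L : ℝ) ^ d)⁻¹ * (8 * (((d : ℝ) + 1) * (L : ℝ)) ^ 2 * a k' + 8 * wq k') ^ 2 * ((d : ℝ) * Μ k')))
      ≤ s ^ (k' + 1 - k') * (tG * Γ k' + tM k' * Μ k') := by
    have hin : 0 ≤ 2 * ((L : ℝ) ^ d)⁻¹ * (L : ℝ) * ((L : ℝ) * Γ k')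
        + 2 * ((L : ℝ) ^ d)⁻¹ * (8 * (((d : ℝ) + 1) * (L : ℝ)) ^ 2 * a k' + 8 * wq k') ^ 2 * ((d : ℝ) * Μ k') := by
      have := hΓ k'; have := hΜ k'; positivity
    calc (d : ℝ) * (((L : ℝ) ^ (k' + 1) - 1) / 2) ^ 2 * (((L : ℝ) ^ k')⁻¹ ^ 2 *
          (2 * ((L : ℝ) ^ d)⁻¹ * (L : ℝ) * ((L : ℝ) * Γ k')
            + 2 * ((L : ℝ) ^ d)⁻¹ * (8 * (((d : ℝ) + 1) * (L : ℝ)) ^ 2 * a k' + 8 * wq k') ^ 2 * ((d : ℝ) * Μ k')))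
        = (d : ℝ) * ((((L : ℝ) ^ (k' + 1) - 1) / 2) ^ 2 * ((L : ℝ) ^ k')⁻¹ ^ 2) *
          (2 * ((L : ℝ) ^ d)⁻¹ * (L : ℝ) * ((L : ℝ) * Γ k')
            + 2 * ((L : ℝ) ^ d)⁻¹ * (8 * (((d : ℝ) + 1) * (L : ℝ)) ^ 2 * a k' + 8 * wq k') ^ 2 * ((d : ℝ) * Μ k')) := by ring
      _ ≤ (d : ℝ) * ((L : ℝ) ^ 2 / 4) *
          (2 * ((L : ℝ) ^ d)⁻¹ * (L : ℝ) * ((L : ℝ) * Γ k')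
            + 2 * ((L : ℝ) ^ d)⁻¹ * (8 * (((d : ℝ) + 1) * (L : ℝ)) ^ 2 * a k' + 8 * wq k') ^ 2 * ((d : ℝ) * Μ k')) :=
          mul_le_mul_of_nonneg_right (mul_le_mul_of_nonneg_left hwt (by positivity)) hin
      _ = s ^ (k' + 1 - k') * (tG * Γ k' + tM k' * Μ k') := by
          rw [show k' + 1 - k' = 1 by omega, pow_one, htG, htM]
          field_simp
  -- COMB
  have hCOMB : ∀ j ∈ range k', s ^ (k' - 1 - j) * (((L : ℝ) ^ (j + 1) - 1) / 2) ^ 2 *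
        (((L : ℝ) ^ j)⁻¹ ^ 2 *
          (((L : ℝ) ^ d)⁻¹ *
              (3 * N * ((n : ℝ) + 1) ^ 2 * ((d : ℝ) * ((d : ℝ) * ((A : ℝ) ^ d * Γ j)))
                + (12 * N * ((n : ℝ) + 1) ^ 2 * (d : ℝ) ^ 3 * (n : ℝ) ^ 2 * a j ^ 2
                    + 3 * (2 * d * L * δ j + 2 * ((3 * d + 1) * n : ℝ) ^ 2 * a j) ^ 2) * ((d : ℝ) * ((d : ℝ) * ((A : ℝ) ^ d * Μ j))))
            + 3 * ((L : ℝ) ^ 2)⁻¹ * ((L : ℝ) ^ d)⁻¹ * ((d : ℝ) * Δ j))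
        + ((L : ℝ) ^ j)⁻¹ ^ 2 *
          (((L : ℝ) ^ d)⁻¹ *
              (3 * N * ((n : ℝ) + 1) ^ 2 * ((d : ℝ) * ((d : ℝ) * ((A : ℝ) ^ d * Γ j)))
                + (12 * N * ((n : ℝ) + 1) ^ 2 * (d : ℝ) ^ 3 * (n : ℝ) ^ 2 * a j ^ 2
                    + 3 * (2 * d * L * δ j + 2 * ((3 * d + 1) * n : ℝ) ^ 2 * a j) ^ 2) * ((d : ℝ) * ((d : ℝ) * ((A : ℝ) ^ d * Μ j))))
            + 3 * ((L : ℝ) ^ 2)⁻¹ * ((L : ℝ) ^ d)⁻¹ * ((d : ℝ) * Δ j)))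
      ≤ s ^ (k' + 1 - j) * ((L : ℝ)⁻¹ * (((L : ℝ) ^ 2 / 4) * 2 *
          (((L : ℝ) ^ d)⁻¹ * (3 * N * ((n : ℝ) + 1) ^ 2 * ((d : ℝ) * ((d : ℝ) * ((A : ℝ) ^ d * Γ j))) + P j * ((d : ℝ) * ((d : ℝ) * ((A : ℝ) ^ d * Μ j))))
            + 3 * ((L : ℝ) ^ 2)⁻¹ * ((L : ℝ) ^ d)⁻¹ * ((d : ℝ) * Δ j)))) := by
    intro j hj
    have hj' : j < k' := Finset.mem_range.mp hj
    have hB0 : 0 ≤ ((L : ℝ) ^ d)⁻¹ * (3 * N * ((n : ℝ) + 1) ^ 2 * ((d : ℝ) * ((d : ℝ) * ((A : ℝ) ^ d * Γ j))) + P j * ((d : ℝ) * ((d : ℝ) * ((A : ℝ) ^ d * Μ j))))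
        + 3 * ((L : ℝ) ^ 2)⁻¹ * ((L : ℝ) ^ d)⁻¹ * ((d : ℝ) * Δ j) := by
      have := hΓ j; have := hΜ j; have := hΔ j; have := hP0 j; positivity
    have hw := weight_sq_le hL1 j
    have hPj : 12 * N * ((n : ℝ) + 1) ^ 2 * (d : ℝ) ^ 3 * (n : ℝ) ^ 2 * a j ^ 2 + 3 * (2 * d * L * δ j + 2 * ((3 * d + 1) * n : ℝ) ^ 2 * a j) ^ 2 = P j := by
      rw [hP]
    rw [hPj, pow_comb hL0.ne' hs2 hj']
    obtain ⟨B, hB⟩ : ∃ t : ℝ, t = ((L : ℝ) ^ d)⁻¹ * (3 * N * ((n : ℝ) + 1) ^ 2 * ((d : ℝ) * ((d : ℝ) * ((A : ℝ) ^ d * Γ j)))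
        + P j * ((d : ℝ) * ((d : ℝ) * ((A : ℝ) ^ d * Μ j)))) + 3 * ((L : ℝ) ^ 2)⁻¹ * ((L : ℝ) ^ d)⁻¹ * ((d : ℝ) * Δ j) := ⟨_, rfl⟩
    rw [← hB] at hB0 ⊢
    have hk0 : 0 ≤ s ^ (k' + 1 - j) * (L : ℝ)⁻¹ := by positivity
    calc s ^ (k' + 1 - j) * (L : ℝ)⁻¹ * (((L : ℝ) ^ (j + 1) - 1) / 2) ^ 2 * (((L : ℝ) ^ j)⁻¹ ^ 2 * B + ((L : ℝ) ^ j)⁻¹ ^ 2 * B)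
        = s ^ (k' + 1 - j) * (L : ℝ)⁻¹ * (((((L : ℝ) ^ (j + 1) - 1) / 2) ^ 2 * ((L : ℝ) ^ j)⁻¹ ^ 2) * (2 * B)) := by ring
      _ ≤ s ^ (k' + 1 - j) * (L : ℝ)⁻¹ * (((L : ℝ) ^ 2 / 4) * (2 * B)) :=
          mul_le_mul_of_nonneg_left (mul_le_mul_of_nonneg_right hw (by positivity)) hk0
      _ = _ := by ring
  -- O-group
  have hO : ∀ i ∈ range (k' + 1), s ^ (k' - i) *
        ((N / 2 * (d : ℝ) ^ 2 * ((L : ℝ) - 1) ^ 2 * (L : ℝ) ^ 2 * ((d : ℝ) * Γ i)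
          + (8 * (d : ℝ) ^ 6 * ((L : ℝ) - 1) ^ 6 + 2 * N * (d : ℝ) ^ 5 * ((L : ℝ) - 1) ^ 4 * (L : ℝ) ^ 2) * a i ^ 2 * ((d : ℝ) * Μ i))
        + (N / 2 * (d : ℝ) ^ 2 * ((L : ℝ) - 1) ^ 2 * (L : ℝ) ^ 2 * ((d : ℝ) * Γ i)
          + (8 * (d : ℝ) ^ 6 * ((L : ℝ) - 1) ^ 6 + 2 * N * (d : ℝ) ^ 5 * ((L : ℝ) - 1) ^ 4 * (L : ℝ) ^ 2) * a i ^ 2 * ((d : ℝ) * Μ i)))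
      = s ^ (k' + 1 - i) * (s⁻¹ * (2 * (N / 2 * (d : ℝ) ^ 2 * ((L : ℝ) - 1) ^ 2 * (L : ℝ) ^ 2 * ((d : ℝ) * Γ i)
          + (8 * (d : ℝ) ^ 6 * ((L : ℝ) - 1) ^ 6 + 2 * N * (d : ℝ) ^ 5 * ((L : ℝ) - 1) ^ 4 * (L : ℝ) ^ 2) * a i ^ 2 * ((d : ℝ) * Μ i)))) := by
    intro i hi
    have hi' : i ≤ k' := Nat.lt_succ_iff.mp (Finset.mem_range.mp hi)
    rw [pow_O hs0.ne' hi']; ring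
  -- the three groups against the kernel
  have hf1 : ∀ i ∈ range (k' + 1), 0 ≤ s ^ (k' + 1 - i) * (tG * Γ i + tM i * Μ i) := fun i _ => by
    have := hΓ i; have := hΜ i; have := htM0 i; positivity
  have hf2 : ∀ i ∈ range (k' + 1), 0 ≤ s ^ (k' + 1 - i) * (cG * Γ i + cM i * Μ i + cD * Δ i) := fun i _ => by
    have := hΓ i; have := hΜ i; have := hΔ i; have := hcM0 i; positivity
  have h1 : (d : ℝ) * (((L : ℝ) ^ (k' + 1) - 1) / 2) ^ 2 * (((L : ℝ) ^ k')⁻¹ ^ 2 *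
        (2 * ((L : ℝ) ^ d)⁻¹ * (L : ℝ) * ((L : ℝ) * Γ k')
          + 2 * ((L : ℝ) ^ d)⁻¹ * (8 * (((d : ℝ) + 1) * (L : ℝ)) ^ 2 * a k' + 8 * wq k') ^ 2 * ((d : ℝ) * Μ k')))
      ≤ ∑ i ∈ range (k' + 1), s ^ (k' + 1 - i) * (tG * Γ i + tM i * Μ i) :=
    hTOP.trans (Finset.single_le_sum (f := fun i => s ^ (k' + 1 - i) * (tG * Γ i + tM i * Μ i)) hf1
      (Finset.mem_range.mpr (Nat.lt_succ_self k')))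
  -- COMB against the kernel (the doubled bracket is never re-typed: `Finset.sum_le_sum hCOMB`)
  have hsub : range k' ⊆ range (k' + 1) := Finset.range_mono (Nat.le_succ k')
  have h2a := mul_le_mul_of_nonneg_left (Finset.sum_le_sum hCOMB) (show (0 : ℝ) ≤ 2 * (d : ℝ) * cL by positivity)
  have h2b : 2 * (d : ℝ) * cL * ∑ j ∈ range k', s ^ (k' + 1 - j) * ((L : ℝ)⁻¹ * (((L : ℝ) ^ 2 / 4) * 2 *
          (((L : ℝ) ^ d)⁻¹ * (3 * N * ((n : ℝ) + 1) ^ 2 * ((d : ℝ) * ((d : ℝ) * ((A : ℝ) ^ d * Γ j))) + P j * ((d : ℝ) * ((d : ℝ) * ((A : ℝ) ^ d * Μ j))))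
            + 3 * ((L : ℝ) ^ 2)⁻¹ * ((L : ℝ) ^ d)⁻¹ * ((d : ℝ) * Δ j))))
      = ∑ j ∈ range k', s ^ (k' + 1 - j) * (cG * Γ j + cM j * Μ j + cD * Δ j) := by
    rw [Finset.mul_sum]
    refine Finset.sum_congr rfl fun j _ => ?_
    rw [hcG, hcM, hcD]
    ring
  have h2c : ∑ j ∈ range k', s ^ (k' + 1 - j) * (cG * Γ j + cM j * Μ j + cD * Δ j)
      ≤ ∑ i ∈ range (k' + 1), s ^ (k' + 1 - i) * (cG * Γ i + cM i * Μ i + cD * Δ i) :=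
    Finset.sum_le_sum_of_subset_of_nonneg hsub fun i hi _ => hf2 i hi
  have h2 := (h2a.trans_eq h2b).trans h2c
  -- O-group against the kernel
  have h3a := congrArg (fun x : ℝ => 2 * cL * x) (Finset.sum_congr rfl hO)
  have h3b : 2 * cL * ∑ i ∈ range (k' + 1), s ^ (k' + 1 - i) * (s⁻¹ * (2 * (N / 2 * (d : ℝ) ^ 2 * ((L : ℝ) - 1) ^ 2 * (L : ℝ) ^ 2 * ((d : ℝ) * Γ i)
          + (8 * (d : ℝ) ^ 6 * ((L : ℝ) - 1) ^ 6 + 2 * N * (d : ℝ) ^ 5 * ((L : ℝ) - 1) ^ 4 * (L : ℝ) ^ 2) * a i ^ 2 * ((d : ℝ) * Μ i))))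
      = ∑ i ∈ range (k' + 1), s ^ (k' + 1 - i) * (oG * Γ i + oM i * Μ i) := by
    rw [Finset.mul_sum]
    refine Finset.sum_congr rfl fun i _ => ?_
    rw [hoG, hoM]
    ring
  have h3 := h3a.trans h3b
  -- knit (the whole of TOP + COMB + O sits inside print's `3·(…)`)
  have hfin := mul_le_mul_of_nonneg_left (add_le_add (add_le_add h1 h2) h3.le) (show (0 : ℝ) ≤ 3 by norm_num)
  refine hfin.trans (le_of_eq ?_)
  rw [← Finset.sum_add_distrib, ← Finset.sum_add_distrib, Finset.mul_sum]
  refine Finset.sum_congr rfl fun i _ => ?_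
  rw [htG, hcG, hoG, htM, hcM, hoM, hcD, hP]
  ring

end Summit.QuantumFields.YangMills.Theorems.Prop7CornerCombGaugeRowKernel

end
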